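import Summits.QuantumFields.YangMills.Theorems.UnitScaleTiltProp8FlatPortCor28Pad
import HarnessLib

/-!
# Route `UnitScaleTilt`, crux K1 child «MinimiserStabilityRegPr» (stmt-QuantumFields-19200), v8 pillar **P2 `stub_flatOpsCubeSeq`** — THE PORT BRIDGE, file 6:
# **[Balaban1984PropagatorsII] PROPOSITION 2.7 (2.149) — THE ENTRIES OF `(QGQ*)⁻¹` — AT k LEVELS FOR EVERY TORUS FAMILY, EVERY ODD `L ≥ 5`, `k ≥ 1`, WITHOUT THE
# PLACEMENT HYPOTHESIS** (lit-balaban W1's hypothesis-free `B6QGQCoerciveKLevelV1.prop27_kLevel_unconditional`, binders `2 ≤ k`, `P′ ≥ 5`, `Placed`, applied to the padded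
# family `B6PadLevelV1.padT D` and transported back with file 4's `EE_UI` / `UI_single` / `beta_pad`) — the input `h2149` of r03's composition step `B6Cor28KLevelV1.comp_entry_le`,
# by which the second-order kernel rows (k3), (k4) of `H` are reached (file 7)

Cell `ym3-torus` (HUMAN RULING D-0037, YM ladder rung R3), seat `ym3-torus-p1` gen 17.  `--supports stmt-QuantumFields-19200 --as helper`; count-neutral; def-free.

WHAT IS PROVED (sorry-free; axioms standard; no definition): `lam_pad` (the conjugation weights `Λ_i` of `B6Prop27KLevelV1` do not see the padding) and
**`prop27_kLevel_pad`** = `prop27_kLevel_unconditional` with `(2 ≤ k, P′ ≥ 5, Placed)` replaced by `(1 ≤ k, k + 1 ≤ m + K, P′ = L·P″, P″ ≥ 5)`, same constants, same conclusion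
`|⟪e_i, (QGQ*)⁻¹e_{i′}⟫| ≤ Λ_i⁻¹Λ_{i′}⁻¹·(2/γ₀)·e^{−δ₄·d_T(β i, β i′)}` for the genuine `(QGQ*)⁻¹ = EE (domT hN D hk)`.
HONEST SCOPE: bookkeeping over landed certificates; inherits `M_h = Lᵃ ≥ 8`, `R ≥ 2L²`, `4 ≤ ℓ`, the band, `M₂ ≤ L·M_h`, `N₁ + 1 ≤ R·L·M_h`.  NOT a claim about the mass gap.

References: T. Bałaban, CMP **96** (1984) 223–250 [Balaban1984PropagatorsII] Prop. 2.7 (2.147)–(2.149) p.248–249, (2.1)–(2.4) p.224.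
-/

set_option autoImplicit false

noncomputable section

open scoped BigOperators InnerProductSpace

namespace Summit.QuantumFields.YangMills.Theorems.FlatPortProp27Pad

open Literature.MathematicalPhysics.QuantumFieldTheory.Balaban1983to89
open B6MultiLevelBoxOperator (N0)
open B6MultiLevelTorusOperator (TDomains)
open B6Geom246MultiLevelTorus (geomT)
open B6GlobalChartV1 (PV domT)
open B6Ineq2142KLevelV1 (β)
open B6Prop27KLevelV1 (lam)
open B6SectAOperatorsV1 (BondIdx)
open B6SectAVectorModelV1 (EE)
open B6RandomWalk (delta3)
open B6QGQCoerciveKLevelV1 (gam0 prop27_kLevel_unconditional)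
open B6CubeWindowV1 (GlobalBand)
open B6PadLevelV1 (padT hN_pad placed_pad sameOm_domT_pad dist_eT globalBand_pad)
open FlatPortCor28Pad (UI_single EE_UI beta_pad)

variable {d ℓ m K : ℕ} {hd : 1 ≤ d + 1} {hL : Odd (ℓ + 1) ∧ 1 < ℓ + 1}
variable {Mh k R : ℕ} {P' P'' : Fin (d + 1) → ℕ}

/-- the conjugation weight `Λ_i` depends only on the level of the index bond: unchanged under padding. [cite: Balaban1984PropagatorsII, (2.81) p.237, bookkeeping] -/
theorem lam_pad (hN : ∀ μ, N0 ℓ Mh k P' μ = (PV d ℓ m K hd hL).sitesPerDir 0) (D : TDomains d ℓ Mh k P' R) (hk : k ≤ m + K)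
    (hLP : ∀ μ, P' μ = (ℓ + 1) * P'' μ) (hk' : k + 1 ≤ m + K) (cf : ℝ) (cI : BondIdx (domT hN D hk)) :
    lam (hN_pad hN hLP) (padT D hLP) hk' cf ((sameOm_domT_pad hN D hk hLP hk').idxB.symm cI) = lam hN D hk cf cI := rfl

/-- **[B6] PROPOSITION 2.7 (2.149) AT k LEVELS, EVERY ODD `L ≥ 5`, `k ≥ 1`, NO PLACEMENT HYPOTHESIS**: the binders of `B6QGQCoerciveKLevelV1.prop27_kLevel_unconditional` with
`(2 ≤ k, P′ ≥ 5, Placed)` replaced by `(1 ≤ k, k + 1 ≤ m + K, P′ = L·P″, P″ ≥ 5)`; same constants `σ₁, A′, M₂, c, N₁`, same entry bound for `(QGQ*)⁻¹` of `domT hN D hk`.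
[cite: Balaban1984PropagatorsII, Prop. 2.7 (2.147)–(2.149) p.248–249, (2.1)–(2.4) p.224] -/
theorem prop27_kLevel_pad (d ℓ : ℕ) (hd : 1 ≤ d + 1) (hL : Odd (ℓ + 1) ∧ 1 < ℓ + 1) {b₀ b₁ : ℝ} (hb₀ : 0 < b₀) (hb₁ : b₀ ≤ b₁) :
    ∃ σ₁ : ℝ, 0 < σ₁ ∧ ∀ (σ : ℝ), 0 < σ → σ ≤ σ₁ → ∀ (α : ℝ), 0 < α → α < 1 →
    ∃ (A' M₂ c : ℝ) (N₁ : ℕ), 0 < A' ∧ 0 < M₂ ∧ 0 ≤ c ∧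
    ∀ (m K : ℕ) {Mh k R : ℕ} {P' : Fin (d + 1) → ℕ}
      (hN : ∀ μ, N0 ℓ Mh k P' μ = (PV d ℓ m K hd hL).sitesPerDir 0) (D : TDomains d ℓ Mh k P' R) (hk : k ≤ m + K) (_ : 1 ≤ k) (_ : k + 1 ≤ m + K)
      {P'' : Fin (d + 1) → ℕ} (_ : ∀ μ, P' μ = (ℓ + 1) * P'' μ) (_ : ∀ μ, 5 ≤ P'' μ)
      {a : ℕ} (_ : Mh = (ℓ + 1) ^ a) (_ : 8 ≤ Mh) (_ : 2 * (ℓ + 1) ^ 2 ≤ R) (_ : 4 ≤ ℓ)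
      (_ : M₂ ≤ ((ℓ : ℝ) + 1) * Mh) (_ : N₁ + 1 ≤ R * ((ℓ + 1) * Mh))
      {cf : ℝ} (hcf : cf ≠ 0) {w : BondIdx (domT hN D hk) → ℝ} (hw : ∀ i, 0 < w i) (_ : GlobalBand b₀ b₁ cf w),
      ∀ i i' : BondIdx (domT hN D hk),
        |⟪EuclideanSpace.single i (1 : ℝ), EE (domT hN D hk) hcf hw (EuclideanSpace.single i' (1 : ℝ))⟫_ℝ| ≤
          (lam hN D hk cf i)⁻¹ * (lam hN D hk cf i')⁻¹ * (2 / gam0 d ℓ b₁ *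
            Real.exp (-(min (delta3 α (2 * σ) / 4) (gam0 d ℓ b₁ / A' / (2 * (1 * (4 / delta3 α (2 * σ)) * (2 * ((d : ℝ) + 1) * c)) + 1)) *
              (geomT D).dist (β hN D hk i) (β hN D hk i')))) := by
  obtain ⟨σ₁, hσ₁, h⟩ := prop27_kLevel_unconditional d ℓ hd hL hb₀ hb₁
  refine ⟨σ₁, hσ₁, fun σ hσ hσ1 α hα hα1 => ?_⟩
  obtain ⟨A', M₂, c, N₁, hA', hM₂, hc, hmain⟩ := h σ hσ hσ1 α hα hα1
  refine ⟨A', M₂, c, N₁, hA', hM₂, hc, ?_⟩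
  intro m K Mh k R P' hN D hk hk1 hk' P'' hLP hP5 a hMha hM8 hR2 hℓ hM hRM cf hcf w hw hwb i i'
  have hS := sameOm_domT_pad hN D hk hLP hk'
  have hw' : ∀ j, 0 < (w ∘ hS.idxB) j := fun j => hw _
  have key := hmain m K (hN_pad hN hLP) (padT D hLP) hk' (by omega) hMha hM8 hR2 hP5 hℓ (placed_pad D hLP hP5) hM hRM hcf hw'
    (globalBand_pad D hLP hN hk hk' hwb) (hS.idxB.symm i) (hS.idxB.symm i')
  rw [UI_single hS i, UI_single hS i', EE_UI hS hcf hw hw', hS.UI.inner_map_map, lam_pad hN D hk hLP hk' cf i, lam_pad hN D hk hLP hk' cf i',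
    beta_pad hN D hk hLP hk' hk1 i, beta_pad hN D hk hLP hk' hk1 i', dist_eT] at key
  exact key

end Summit.QuantumFields.YangMills.Theorems.FlatPortProp27Pad

end
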